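import Summits.ResolutionOfSingularities.ResolutionOfSingularities.Theorems.PurelyInseparableDim4InScopeWinCertFast2
import HarnessLib
import HarnessLib.Audit.Tags

/-!
# Purely inseparable fourfolds — IN-SCOPE WIN CERTIFICATES, FAST CHECKER 3 (Horner translation on sorted term lists)
# [OURS · counted 0 · a certificate format for OUR frame v4, not about resolution]

Census cell «res-dim4-pi» (D-0157 DOOR 2), width seat `res-dim4-p-13` (generation 4).  Sequel of res-dim4-p-14's
`PurelyInseparableDim4InScopeWinCertFast` (`equiHB`, Hasse–Taylor test) and `…Fast2` (`stepDn`, normalised children).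
WHY.  With the Hasse–Taylor test in place, the remaining kernel cost of a MOVE row sits in the CHILD `stepD q S j b s` at each
equimultiple reply: `transAll b` expands every monomial `x^e` into `∏_{i : bᵢ ≠ 0} (eᵢ + 1)` raw terms before anything is
collected, and `stepDn`'s normaliser scans that raw list once per entry; on the census states this cell still files
(60–330 monomials, degrees up to 18) that is 10⁶–10⁷ list operations per reply and sizes the file groups (res-dim4-p-13 g3:
group 87 timed out; groups 97 · 111 · 122 cut into 8 / 7 / 20 parts by this cost).

WHAT.  `stepDH` computes the SAME presented state (`stepDH_toState`) with the translation done by HORNER'S RULE on SORTED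
term lists: for one variable, `F = xᵢ·Q + R ↦ F(xᵢ + β) = xᵢ·Q(xᵢ + β) + β·Q(xᵢ + β) + R`, recursively in the `xᵢ`-degree,
the three summands combined by a linear MERGE of sorted lists that collects like terms and drops zero sums (`mergeF`); the
input is sorted once (`sortT`, a merge sort), and `quotI` / `restI` / `shiftUp` / `scaleT` preserve the order, so every
intermediate list is duplicate-free with one entry per monomial.  Only the identities `evalT (…) = …` are proved — the
order serves efficiency, not soundness (each recursion carries a `fuel` bound; on exhaustion the landed expansion is used,
so the identities hold unconditionally).  The checkers `iwinCertTB` / `iwinCertTBL` are `…Fast2`'s with `stepDH` for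
`stepDn` and a child look-up `ichildInH` that compares boundary data first and accepts syntactic equality of term lists
before falling back to the coefficient comparison; soundness is REDUCED row by row to the landed `irowOK`
(`irowOK_of_irowTOK`), so the certified statement is literally the landed one: `InScopeStateWins q row.1.toState`.

Riders as before: `K`-rational replies over the finite field `K` of the certificate only (NOT ∀K); a statement about OUR
frame-v4 game; nothing here proves resolution of singularities in dimension ≥ 4 / characteristic `p`; F4-C(2,2) neither
proved nor refuted.  [OURS · counted 0 · AI kernel work, weaker than expert review.]
bears_on: LADDER-RESOLUTION:D157-DOOR2 (res-dim4-pi · F4-C instrument · certificate format). Supports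
stmt-ResolutionOfSingularities-16155 (helper).
-/

set_option linter.dupNamespace false

noncomputable section

namespace Summit.ResolutionOfSingularities.ResolutionOfSingularities.Theorems.PIDim4

namespace InScopeWinCert

open MvPolynomial
open StepKit WinCertSound ScopeBlind
open Literature.AlgebraicGeometry.Resolution
open Literature.AlgebraicGeometry.Resolution.CentreBlowup

variable {n : ℕ} {K : Type} [Field K]

/-! ## 1. Term-list algebra: shifting, scaling, division by a variable -/
/-- Multiplication by `x_i` raises the `i`-th exponent. [folklore] -/
theorem X_mul_monomial_expo (i : Fin n) (e : Fin n → ℕ) (c : K) :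
    X i * monomial (expo e) c = (monomial (expo (Function.update e i (e i + 1))) c : MvPolynomial (Fin n) K) := by
  have hs : Finsupp.single i 1 + expo e = expo (Function.update e i (e i + 1)) := by
    ext k
    rw [Finsupp.add_apply, expo_apply, expo_apply, Finsupp.single_apply, Function.update_apply]
    by_cases h : i = k
    · subst h; rw [if_pos rfl, if_pos rfl, add_comm]
    · rw [if_neg h, if_neg (Ne.symm h), zero_add]
  rw [show (X i : MvPolynomial (Fin n) K) = monomial (Finsupp.single i 1) 1 from rfl, monomial_mul, one_mul, hs]

/-- Multiply by `x_i` (order-preserving on sorted lists). [folklore] -/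
def shiftUp (i : Fin n) (L : Terms n K) : Terms n K := L.map fun t => (Function.update t.1 i (t.1 i + 1), t.2)

/-- `shiftUp` presents `x_i · F`. [folklore] -/
theorem evalT_shiftUp (i : Fin n) : ∀ L : Terms n K, evalT (shiftUp i L) = X i * evalT L
  | [] => by simp [shiftUp]
  | t :: L => by
    have ih := evalT_shiftUp i L
    unfold shiftUp at ih ⊢
    rw [List.map_cons, evalT_cons, evalT_cons, mul_add, X_mul_monomial_expo, ih]

/-- Scale the coefficients. [folklore] -/
def scaleT (β : K) (L : Terms n K) : Terms n K := L.map fun t => (t.1, β * t.2)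

/-- `scaleT` presents `C β · F`. [folklore] -/
theorem evalT_scaleT (β : K) : ∀ L : Terms n K, evalT (scaleT β L) = C β * evalT L
  | [] => by simp [scaleT]
  | t :: L => by
    have ih := evalT_scaleT β L
    unfold scaleT at ih ⊢
    rw [List.map_cons, evalT_cons, evalT_cons, mul_add, C_mul_monomial, ih]

/-- The terms free of `x_i` (order-preserving). [folklore] -/
def restI (i : Fin n) (L : Terms n K) : Terms n K := L.filter fun t => t.1 i = 0

/-- The terms divisible by `x_i`, divided by `x_i` (order-preserving). [folklore] -/
def quotI (i : Fin n) (L : Terms n K) : Terms n K :=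
  (L.filter fun t => t.1 i ≠ 0).map fun t => (Function.update t.1 i (t.1 i - 1), t.2)

/-- **Division by `x_i` with remainder** on term lists: `F = x_i · Q + R`. [folklore] -/
theorem evalT_split (i : Fin n) : ∀ L : Terms n K, evalT L = X i * evalT (quotI i L) + evalT (restI i L)
  | [] => by simp [quotI, restI]
  | t :: L => by
    have ih := evalT_split i L
    simp only [quotI, restI, List.filter_cons] at ih ⊢
    by_cases h : t.1 i = 0
    · simp only [h, ne_eq, not_true_eq_false, decide_false, decide_true, Bool.false_eq_true, ↓reduceIte,
        evalT_cons]
      rw [ih, add_left_comm]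
    · simp only [h, ne_eq, not_false_eq_true, decide_true, decide_false, Bool.false_eq_true, ↓reduceIte,
        List.map_cons, evalT_cons]
      rw [mul_add, X_mul_monomial_expo, Function.update_idem, Function.update_self, Nat.sub_add_cancel
        (Nat.pos_of_ne_zero h), Function.update_eq_self, ih, add_assoc]

/-- The shift `x_i ↦ x_i + β` fixes a monomial without `x_i`. [folklore] -/
theorem tau_monomial_of_eq_zero (i : Fin n) (β : K) {e : Fin n → ℕ} (h : e i = 0) (c : K) :
    tau i β (monomial (expo e) c) = monomial (expo e) c := by
  have hu : Function.update e i 0 = e := Function.update_eq_self_iff.mpr h.symm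
  rw [tau_monomial, h]
  simp [hu]

/-- The shift `x_i ↦ x_i + β` fixes a polynomial presented without `x_i`. [folklore] -/
theorem tau_evalT_restI (i : Fin n) (β : K) : ∀ L : Terms n K, tau i β (evalT (restI i L)) = evalT (restI i L)
  | [] => by simp [restI]
  | t :: L => by
    have ih := tau_evalT_restI i β L
    simp only [restI, List.filter_cons] at ih ⊢
    by_cases h : t.1 i = 0
    · simp only [h, decide_true, ↓reduceIte, evalT_cons, map_add]
      rw [ih, tau_monomial_of_eq_zero i β h]
    · simp only [h, decide_false, Bool.false_eq_true, ↓reduceIte]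
      exact ih

/-- The sum of the presented polynomials of a list of term lists. [folklore] -/
def evalTs : List (Terms n K) → MvPolynomial (Fin n) K
  | [] => 0
  | A :: ls => evalT A + evalTs ls

/-- Concatenation presents the sum. [folklore] -/
theorem evalT_flatten : ∀ ls : List (Terms n K), evalT ls.flatten = evalTs ls
  | [] => rfl
  | A :: rest => by rw [List.flatten_cons, evalT_append, evalT_flatten rest, evalTs]

/-- Singletons present the same sum. [folklore] -/
theorem evalTs_singletons : ∀ L : Terms n K, evalTs (L.map fun t => [t]) = evalT L
  | [] => rfl
  | t :: L => by
    rw [List.map_cons, evalTs, evalTs_singletons L, evalT_cons, evalT_cons, evalT_nil, add_zero]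

variable [DecidableEq K]

/-! ## 2. Sorted merging (like terms combined, zero sums dropped) and the Horner shift -/
/-- Lexicographic `<` on lists of naturals (the order used to keep term lists sorted). [folklore] -/
def lexLT : List ℕ → List ℕ → Bool
  | [], [] => false
  | [], _ :: _ => true
  | _ :: _, [] => false
  | a :: l, b :: m => if a < b then true else if a = b then lexLT l m else false

/-- Strict order test on exponent functions (lexicographic on the value list).  No property of it is used in a
soundness proof. [folklore] -/
def ltE (e e' : Fin n → ℕ) : Bool := lexLT (List.ofFn e) (List.ofFn e')

/-- **Merge** of two term lists (sorted inputs give a sorted output): like terms are combined, zero sums dropped;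
`fuel` bounds the recursion (on exhaustion the lists are concatenated). [folklore] -/
def mergeF : ℕ → Terms n K → Terms n K → Terms n K
  | 0, A, B => A ++ B
  | _ + 1, [], B => B
  | _ + 1, t :: A, [] => t :: A
  | f + 1, t :: A, u :: B =>
    if t.1 = u.1 then (if t.2 + u.2 = 0 then mergeF f A B else (t.1, t.2 + u.2) :: mergeF f A B)
    else if ltE t.1 u.1 then t :: mergeF f A (u :: B) else u :: mergeF f (t :: A) B

/-- `mergeF` presents the sum. [folklore] -/
theorem evalT_mergeF : ∀ (f : ℕ) (A B : Terms n K), evalT (mergeF f A B) = evalT A + evalT B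
  | 0, A, B => evalT_append A B
  | _ + 1, [], B => by rw [mergeF, evalT_nil, zero_add]
  | _ + 1, t :: A, [] => by rw [mergeF, evalT_nil, add_zero]
  | f + 1, t :: A, u :: B => by
    have hsum : t.1 = u.1 → monomial (expo t.1) t.2 + monomial (expo u.1) u.2 =
        (monomial (expo t.1) (t.2 + u.2) : MvPolynomial (Fin n) K) := fun h1 => by
      rw [h1, ← map_add]
    rw [mergeF]
    split_ifs with h1 h2 h3
    · rw [evalT_mergeF f A B, evalT_cons, evalT_cons, add_add_add_comm, hsum h1, h2, map_zero, zero_add]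
    · rw [evalT_cons, evalT_mergeF f A B, evalT_cons, evalT_cons, add_add_add_comm, hsum h1]
    · simp only [evalT_cons, evalT_mergeF f A (u :: B)]
      abel
    · simp only [evalT_cons, evalT_mergeF f (t :: A) B]
      abel

/-- Merge with enough fuel. [folklore] -/
def mergeT (A B : Terms n K) : Terms n K := mergeF (A.length + B.length + 1) A B
/-- `mergeT` presents the sum. [folklore] -/
theorem evalT_mergeT (A B : Terms n K) : evalT (mergeT A B) = evalT A + evalT B := evalT_mergeF _ A B

/-- One round of pairwise merges. [folklore] -/
def mergePairs : List (Terms n K) → List (Terms n K)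
  | A :: B :: rest => mergeT A B :: mergePairs rest
  | l => l

/-- `mergePairs` preserves the presented sum. [folklore] -/
theorem evalTs_mergePairs : ∀ ls : List (Terms n K), evalTs (mergePairs ls) = evalTs ls
  | [] => rfl
  | [_] => rfl
  | A :: B :: rest => by
    rw [mergePairs, evalTs, evalTs, evalTs, evalT_mergeT, evalTs_mergePairs rest, add_assoc]

/-- All rounds of the merge sort (`fuel` rounds at most; on exhaustion the lists are concatenated). [folklore] -/
def mergeAllF : ℕ → List (Terms n K) → Terms n K
  | 0, ls => ls.flatten
  | _ + 1, [] => []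
  | _ + 1, [A] => A
  | f + 1, A :: B :: rest => mergeAllF f (mergePairs (A :: B :: rest))

/-- `mergeAllF` presents the sum. [folklore] -/
theorem evalT_mergeAllF : ∀ (f : ℕ) (ls : List (Terms n K)), evalT (mergeAllF f ls) = evalTs ls
  | 0, ls => evalT_flatten ls
  | _ + 1, [] => by rw [mergeAllF, evalTs, evalT_nil]
  | _ + 1, [A] => by rw [mergeAllF, evalTs, evalTs, add_zero]
  | f + 1, A :: B :: rest => by rw [mergeAllF, evalT_mergeAllF f, evalTs_mergePairs]

/-- **Merge sort** of a term list (like terms combined, zeros dropped). [folklore] -/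
def sortT (L : Terms n K) : Terms n K := mergeAllF (L.length + 1) (L.map fun t => [t])

/-- `sortT` presents the same polynomial. [folklore] -/
theorem evalT_sortT (L : Terms n K) : evalT (sortT L) = evalT L := by
  rw [sortT, evalT_mergeAllF, evalTs_singletons]

/-- **ONE-VARIABLE TAYLOR SHIFT by Horner's rule**: `F = x_i·Q + R ↦ x_i·T(Q) ⊕ β·T(Q) ⊕ R` on sorted term lists
(`fuel` bounds the `x_i`-degree; on exhaustion the landed expansion `transVar` is used). [folklore] -/
def taylorH (i : Fin n) (β : K) : ℕ → Terms n K → Terms n K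
  | 0, L => transVar i β L
  | _ + 1, [] => []
  | f + 1, t :: L =>
    mergeT (shiftUp i (taylorH i β f (quotI i (t :: L))))
      (mergeT (scaleT β (taylorH i β f (quotI i (t :: L)))) (restI i (t :: L)))

/-- `taylorH` presents the shifted polynomial. [folklore] -/
theorem evalT_taylorH (i : Fin n) (β : K) : ∀ (f : ℕ) (L : Terms n K), evalT (taylorH i β f L) = tau i β (evalT L)
  | 0, L => (tau_evalT i β L).symm
  | _ + 1, [] => by simp [taylorH]
  | f + 1, t :: L => by
    rw [taylorH, evalT_mergeT, evalT_mergeT, evalT_shiftUp, evalT_scaleT, evalT_taylorH i β f,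
      evalT_split i (t :: L), map_add, map_mul, tau_X, if_pos rfl, tau_evalT_restI]
    ring

/-- The largest `i`-th exponent occurring in the list. [folklore] -/
def maxE (i : Fin n) (L : Terms n K) : ℕ := L.foldr (fun t m => max (t.1 i) m) 0

/-- One-variable shift, Horner form (the identity when `β = 0`). [folklore] -/
def shiftVarH (i : Fin n) (β : K) (L : Terms n K) : Terms n K :=
  if β = 0 then L else taylorH i β (maxE i L + 1) L

/-- `shiftVarH` presents the shifted polynomial. [folklore] -/
theorem evalT_shiftVarH (i : Fin n) (β : K) (L : Terms n K) : evalT (shiftVarH i β L) = tau i β (evalT L) := by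
  unfold shiftVarH
  split_ifs with h
  · rw [h, tau_zero_apply]
  · exact evalT_taylorH i β _ L

/-- **Translation by the point `b`, Horner form**, one variable after the other. [folklore] -/
def transAllH (b : Fin n → K) (L : Terms n K) : Terms n K :=
  (List.finRange n).foldr (fun i acc => shiftVarH i (b i) acc) L

/-- The iterated Horner shifts present the composite translation `tauList`. [folklore] -/
theorem evalT_foldr_shiftVarH (b : Fin n → K) (L : Terms n K) :
    ∀ l : List (Fin n), evalT (l.foldr (fun i acc => shiftVarH i (b i) acc) L) = tauList b l (evalT L)
  | [] => by simp [tauList]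
  | i :: l => by
    rw [List.foldr_cons, evalT_shiftVarH, evalT_foldr_shiftVarH b L l, tauList, AlgHom.comp_apply]

/-- **`transAllH` presents the same polynomial as the landed `transAll`.** [folklore] -/
theorem evalT_transAllH (b : Fin n → K) (L : Terms n K) : evalT (transAllH b L) = evalT (transAll b L) := by
  rw [transAllH, evalT_foldr_shiftVarH, ← translate_eq_tauList, translate_evalT]

/-! ## 3. The step, Horner form -/
/-- **The step on presented states, Horner form**: sort the chart transform once, translate by Horner, clean;
multiplicities and components as in `stepD`. [folklore] -/
def stepDH (q : ℕ) (S : Finset (Fin n)) (j : Fin n) (b : Fin n → K) (s : SData n K) : SData n K :=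
  ⟨cleanL q (transAllH b (sortT (chartL q S j s.L))), (stepD q S j b s).r, (stepD q S j b s).exc⟩

/-- **The Horner child presents the same state as `stepD`.** [folklore] -/
theorem stepDH_toState (q : ℕ) (S : Finset (Fin n)) (j : Fin n) (b : Fin n → K) (s : SData n K) :
    (stepDH q S j b s).toState = (stepD q S j b s).toState := by
  have hL : evalT (stepDH q S j b s).L = evalT (stepD q S j b s).L := by
    change evalT (cleanL q (transAllH b (sortT (chartL q S j s.L)))) = evalT (cleanL q (transAll b (chartL q S j s.L)))
    rw [← deletePthPowers_evalT, ← deletePthPowers_evalT, evalT_transAllH, ← translate_evalT, ← translate_evalT,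
      evalT_sortT]
  simp only [SData.toState, hL]
  rfl

/-! ## 4. The checkers -/
variable [Fintype K]

/-- Child look-up, cheap tests first: boundary vector and exceptional set, then SYNTACTIC equality of the term lists
(both sides sorted and normalised in practice), with the coefficient comparison as fall-back. [folklore] -/
def ichildInH (rest : ICert K) (c : SData 4 K) : Bool :=
  rest.any fun r => decide (c.r = r.1.r) && decide (c.exc = r.1.exc) &&
    (decide (c.L = r.1.L) || StepKit.equivB c.L r.1.L)

omit [Fintype K] in
/-- Soundness of `ichildInH`. [folklore] -/
theorem exists_of_ichildInH [Fintype K] {rest : ICert K} {c : SData 4 K} (h : ichildInH rest c = true) :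
    ∃ r ∈ rest, c.toState = r.1.toState := by
  unfold ichildInH at h
  obtain ⟨r, hr, hrc⟩ := List.any_eq_true.mp h
  simp only [Bool.and_eq_true, Bool.or_eq_true, decide_eq_true_eq] at hrc
  obtain ⟨⟨hr1, hexc⟩, hL⟩ := hrc
  refine ⟨r, hr, (toState_eq_iff c r.1).mpr ?_⟩
  rw [SData.equivB, Bool.and_eq_true, Bool.and_eq_true, decide_eq_true_eq, decide_eq_true_eq]
  refine ⟨⟨?_, hr1⟩, hexc⟩
  rcases hL with hL | hL
  · rw [← evalT_eq_iff_equivB, hL]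
  · exact hL

/-- The zero test and the look-up on a given child. [folklore] -/
def ichildOKH (rest : ICert K) (c : SData 4 K) : Bool := StepKit.equivB c.L [] || ichildInH rest c
/-- B's reply `(j, b)` is harmless (Hasse–Taylor test, Horner child). [folklore] -/
def ireplyTOK (q : ℕ) (rest : ICert K) (s : SData 4 K) (S : Finset (Fin 4)) (j : Fin 4) (b : Fin 4 → K) : Bool :=
  !(equiHB q S j b s) || ichildOKH rest (stepDH q S j b s)

/-- A reply harmless in the Horner form is harmless. [folklore] -/
theorem ireplyOK_of_ireplyTOK {q : ℕ} {rest : ICert K} {s : SData 4 K} {S : Finset (Fin 4)} {j : Fin 4}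
    {b : Fin 4 → K} (h : ireplyTOK q rest s S j b = true) : ireplyOK q rest s S j b = true := by
  unfold ireplyTOK ichildOKH at h
  unfold ireplyOK
  cases hH : equiHB q S j b s with
  | false => rw [equiB_eq_false_of_equiHB hH]; simp
  | true =>
    rw [hH] at h
    simp only [Bool.not_true, Bool.false_or, Bool.or_eq_true] at h
    rw [Bool.or_eq_true, Bool.or_eq_true]
    rcases h with hz | hc
    · refine Or.inl (Or.inr ?_)
      rw [← evalT_eq_zero_iff] at hz ⊢
      rwa [← SData.toState_F, stepDH_toState, SData.toState_F] at hz
    · refine Or.inr ?_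
      obtain ⟨r, hr, hrc⟩ := exists_of_ichildInH hc
      rw [stepDH_toState] at hrc
      exact List.any_eq_true.mpr ⟨r, hr, (toState_eq_iff _ _).mp hrc⟩

/-- The row check (Horner form). [folklore] -/
def irowTOK (q : ℕ) (rest : ICert K) (row : IRow K) : Bool :=
  blindOK q row || !(permB q Finset.univ row.1.L) ||
    (permB q row.2.1 row.1.L &&
      decide (∀ j ∈ row.2.1, ∀ b : Fin 4 → K, b j = 0 → ireplyTOK q rest row.1 row.2.1 j b = true))

/-- **Fast in-scope checker 3** (children LATER in the list). [folklore] -/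
def iwinCertTB (q : ℕ) : ICert K → Bool
  | [] => true
  | row :: rest => irowTOK q rest row && iwinCertTB q rest

/-- **Fast checker 3 with external leaves.** [folklore] -/
def iwinCertTBL (q : ℕ) (L : List (SData 4 K)) : ICert K → Bool
  | [] => true
  | row :: rest => irowTOK q (rest ++ leafRows L) row && iwinCertTBL q L rest

/-! ## 5. Reduction to the landed checkers, soundness -/
/-- A fast-3-OK row is OK. [folklore] -/
theorem irowOK_of_irowTOK {q : ℕ} {rest : ICert K} {row : IRow K} (h : irowTOK q rest row = true) :
    irowOK q rest row = true := by
  unfold irowTOK at h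
  unfold irowOK
  simp only [Bool.or_eq_true, Bool.and_eq_true, Bool.not_eq_true', decide_eq_true_eq] at h ⊢
  rcases h with (hb | ht) | ⟨hp, hr⟩
  · exact Or.inl (Or.inl hb)
  · exact Or.inl (Or.inr ht)
  · exact Or.inr ⟨hp, fun j hj b hb => ireplyOK_of_ireplyTOK (hr j hj b hb)⟩

/-- **Reduction** (closed form). [folklore] -/
theorem iwinCertB_of_iwinCertTB {q : ℕ} : ∀ {T : ICert K}, iwinCertTB q T = true → iwinCertB q T = true
  | [], _ => rfl
  | row :: rest, h => by
    simp only [iwinCertTB, Bool.and_eq_true] at h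
    simp only [iwinCertB, Bool.and_eq_true]
    exact ⟨irowOK_of_irowTOK h.1, iwinCertB_of_iwinCertTB h.2⟩

/-- **Reduction** (external-leaves form). [folklore] -/
theorem iwinCertBL_of_iwinCertTBL {q : ℕ} {L : List (SData 4 K)} :
    ∀ {T : ICert K}, iwinCertTBL q L T = true → iwinCertBL q L T = true
  | [], _ => rfl
  | row :: rest, h => by
    simp only [iwinCertTBL, Bool.and_eq_true] at h
    simp only [iwinCertBL, Bool.and_eq_true]
    exact ⟨irowOK_of_irowTOK h.1, iwinCertBL_of_iwinCertTBL h.2⟩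

/-- **SOUNDNESS OF FAST CHECKER 3.** [folklore] -/
theorem inScopeStateWins_of_iwinCertTB {q : ℕ} {T : ICert K} (h : iwinCertTB q T = true) :
    ∀ row ∈ T, InScopeStateWins q row.1.toState :=
  inScopeStateWins_of_iwinCertB (iwinCertB_of_iwinCertTB h)

/-- **SOUNDNESS OF FAST CHECKER 3 WITH EXTERNAL LEAVES.** [folklore] -/
theorem inScopeStateWins_of_iwinCertTBL {q : ℕ} {L : List (SData 4 K)} (hL : ∀ s ∈ L, InScopeStateWins q s.toState)
    {T : ICert K} (h : iwinCertTBL q L T = true) : ∀ row ∈ T, InScopeStateWins q row.1.toState :=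
  inScopeStateWins_of_iwinCertBL hL (iwinCertBL_of_iwinCertTBL h)

/-! ## 6. Model -/
/-- The PR-12u model certificate `scopeLossCert` (over `𝔽₂`) passes fast checker 3. [OURS · ‖ K] [folklore] -/
theorem iwinCertTB_scopeLossCert : iwinCertTB 2 scopeLossCert = true := by
  decide +kernel

end InScopeWinCert

end Summit.ResolutionOfSingularities.ResolutionOfSingularities.Theorems.PIDim4

end
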